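import Summits.Langlands.Langlands.Theorems.PicardMuOrdinaryMuOrdinaryFamilyRTThornePointAutomorphicDebts
import Summits.Langlands.Langlands.Theorems.PicardMuOrdinaryMuOrdinaryFamilyRTThornePolarizationTransport
import Summits.Langlands.Langlands.Theorems.PicardMuOrdinaryMuOrdinaryFamilyRTThornePolarizationTwist
import Summits.Langlands.Langlands.Theorems.PicardMuOrdinaryMuOrdinaryFamilyRTThorneOrdinaryTwist
import Summits.Langlands.Langlands.Theorems.PicardMuOrdinaryMuOrdinaryFamilyRTThorneBorelBridge
import Summits.Langlands.Langlands.Theorems.PicardMuOrdinaryMuOrdinaryFamilyRTThorneImageLinearDisjoint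
import Summits.Langlands.Langlands.Theorems.PicardMuOrdinaryMuOrdinaryFamilyRTThornePointUnramified
import Summits.Langlands.Langlands.Theorems.PicardMuOrdinaryMuOrdinaryFamilyRTThornePointAbsIrrRestrict
import Summits.Langlands.Langlands.Theorems.PicardMuOrdinaryMuOrdinaryFamilyRTThorneAdequacyResidual
import Literature.NumberTheory.NumberFields.SolubleCMExtensionPrescribedLocal
import Literature.NumberTheory.PAdicHodge.CrystallineOfOrdinaryRegular
import Literature.NumberTheory.GaloisRepresentations.CyclotomicCharacterArtinNorm
import Literature.NumberTheory.GaloisRepresentations.ToLocalRestrictField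
import Literature.NumberTheory.GaloisRepresentations.TateTwistFrobeniusProofs
import Literature.NumberTheory.GaloisRepresentations.CalegariEvenFontaineMazurTwo
import Summits.Langlands.Langlands.Theorems.PicardMuOrdinaryMuOrdinaryFamilyRTThornePAICharPolarization
import Summits.Langlands.Langlands.Theorems.PicardMuOrdinaryMuOrdinaryFamilyRTThornePAIDisjointnessField
import Summits.Langlands.Langlands.Theorems.PicardMuOrdinaryMuOrdinaryFamilyRTThornePAIKillSubgroup
import Summits.Langlands.Langlands.Theorems.PicardMuOrdinaryMuOrdinaryFamilyRTThornePAICharInertia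
import Summits.Langlands.Langlands.Theorems.PicardMuOrdinaryMuOrdinaryFamilyRTThornePAIResidualPoint
import Summits.Langlands.Langlands.Theorems.PicardMuOrdinaryMuOrdinaryFamilyRTThornePAIResidualCompanion
import Summits.Langlands.Langlands.Theorems.PicardMuOrdinaryMuOrdinaryFamilyRTThornePAIWeightTransport
import Summits.Langlands.Langlands.Theorems.PicardMuOrdinaryMuOrdinaryFamilyRTThorneTwistReduction
import HarnessLib

/-!
# PA-I `thorneInputOverL` — assembly of the GALOIS input over the soluble CM extension (lead c3)

The registered stub `stub_thorneInputOverL` (skeleton v8) proved from the LANDED glue lemmas H1 = G5b (character polarization: `c̃ ∈ Γ_{F'⁺}` form ⇒ `c ∈ Γ_ℚ` form), H2 = G6a (kill subgroup at `w ∈ S' ∖ 3`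
for `ρ_y|F'`), H4 = G6b (a character trivial on a killed open subgroup of local inertia is trivial on the global inertia groups over `L`), H5 = G8
(transport of an ordinary weight along `F'_w ↝ L_u` with EXACT characters, canonical Artin data), H6 = G10 (the companion has the residual
representation of the point over `L`, and is irreducible there), H6' = G10' (residual representation + Thorne-adequacy + irreducibility of the twisted
point representation over `L`, tower form), H9 = G2d (a finite `D/F'` whose linear disjointness from `L` keeps the heart image along the tower).
-/

set_option linter.dupNamespace false

namespace Summit.Langlands.Langlands.Cruxes.MuOrdinaryFamilyRT.ThorneMinimalLift

open scoped NumberField Polynomial Matrix Classical TensorProduct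
open Field IsDedekindDomain Polynomial Filter
open Literature.NumberTheory.GaloisRepresentations Literature.NumberTheory.Automorphic Literature.NumberTheory.PAdicHodge
open Literature.NumberTheory.NumberFields
open Summit.Langlands.Langlands.Cruxes.MuOrdinaryFamilyRT.CharZeroDominance

noncomputable section

/-! ## The assembly of PA-I from the glue -/

/-- **PA-I — the Galois input over the soluble CM extension** (registered stub `stub_thorneInputOverL`, assembled from the landed glue and the three
Literature facts; blueprint § 6). -/
theorem thorneInputOverL : ClozelHarrisTaylor2008.exists_solvable_cm_extension_local → GeeGeraghty2012.crystalline_of_ordinary_regular → cyclotomicCharacter_artin_eq_norm → ∀ (𝓐 : ∀ (K : Type) [Field K] [NumberField K] (v : HeightOneSpectrum (𝓞 K)), LocalArtinData (v.adicCompletion K)), (∀ (K : Type) [Field K] [NumberField K] (v : HeightOneSpectrum (𝓞 K)), (𝓐 K v).IsCanonical) → ∀ (f : ℤ[X]) (ι : PadicAlgCl 3 ≃+* ℂ) (e : K →+* ℂ) (S₀ : Finset (HeightOneSpectrum (𝓞 K))) (ρC : FramedGaloisRep K (PadicAlgCl 3) 3) (𝓕 : OrdFamily f ι e S₀ ρC),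 Generic f → PicardInput f ι e S₀ ρC → MainClassPlus f S₀ ρC → PotUnramifiedFamily 𝓕 → ∀ (F' : Type) [Field F'] [NumberField F'] [Algebra K F'] [IsGalois ℚ F'] [NumberField.IsCMField F'] (S' : Finset (HeightOneSpectrum (𝓞 F'))), Module.finrank K F' = 2 → ThreeSplitFromMaximalReal F' → ((rbar f 𝓕.B).comp (absGaloisRestrict K F').toMonoidHom).range = (rbar f 𝓕.B).range → (∀ w : HeightOneSpectrum (𝓞 F'), w.under (𝓞 K) ∈ S₀ → w ∈ S') → ∀ θ : absoluteGaloisGroup F' →ₜ* (PadicAlgCl 3)ˣ, TwistData 𝓕.m F' S' θ → ∀ (y : 𝓕.R →+* PadicAlgCl 3) (ρy : FramedGaloisRep K (PadicAlgCl 3) 3), (∀ g, ρy g = pointRep 𝓕 y g) → FramedRep.IsAbsolutelyIrreducible (ρy.restrictField F') → ∀ rc : FramedGaloisRep F' (PadicAlgCl 3) 3, (∀ w ∈ S', ((3 : ℕ) : 𝓞 F') ∉ w.asIdeal → ∃ U : OpenSubgroup (absoluteGaloisGroup (w.adicCompletion F')), ∀ τ ∈ absInertia (w.adicCompletion F'),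 τ ∈ U → rc (absGaloisRestrict F' (w.adicCompletion F') τ) = 1) → (∀ N : ℕ, ∃ M : ℕ, ∀ r ∈ IsLocalRing.maximalIdeal 𝓕.R ^ M, ‖y r‖ ≤ ((3 : ℝ)⁻¹) ^ N) → (∀ r : 𝓕.R, ‖y r‖ ≤ 1) → (∃ g : GL (Fin 3) (PadicAlgCl 3), ∀ (σ : absoluteGaloisGroup F') (i j : Fin 3), ‖(g⁻¹ * rc σ * g).val i j‖ ≤ 1 ∧ ‖(g⁻¹ * rc σ * g).val i j - (pointRep 𝓕 y (absGaloisRestrict K F' σ)).val i j‖ < 1) → (∀ w : HeightOneSpectrum (𝓞 F'), ((3 : ℕ) : 𝓞 F') ∈ w.asIdeal → ∀ art : LocalArtinData (w.adicCompletion F'), art.IsCanonical → ∃ wt : LabelledWeight (w.adicCompletion F') (PadicAlgCl 3) 3, (∀ τ (i j : Fin 3), i < j → wt τ j + 2 ≤ wt τ i) ∧ rc.IsOrdinaryOfLabelledWeightAt w art wt ∧ ∃ (g : GL (Fin 3) (PadicAlgCl 3)) (U : OpenSubgroup (absoluteGaloisGroup (w.adicCompletion F'))), (∀ τ : absoluteGaloisGroup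 (w.adicCompletion F'), IsUpper3 (g⁻¹ * pointRep 𝓕 y (absGaloisRestrict K F' (absGaloisRestrict F' (w.adicCompletion F') τ)) * g).val) ∧ ∀ τw ∈ WeilGroup.inertia (w.adicCompletion F'), WeilGroup.toAbsGalois (w.adicCompletion F') τw ∈ U → ∀ i : Fin 3, (g⁻¹ * pointRep 𝓕 y (absGaloisRestrict K F' (absGaloisRestrict F' (w.adicCompletion F') (WeilGroup.toAbsGalois (w.adicCompletion F') τw))) * g).val i i = (ordinaryWeightUnit wt i (art.artin τw) : PadicAlgCl 3)) → UnramifiedOff F' S' rc → ∃ (L : Type) (_ : Field L) (_ : NumberField L) (_ : NumberField.IsCMField L) (_ : Algebra F' L) (_ : IsGalois F' L) (_ : IsSolvable (L ≃ₐ[F'] L)) (τ : absoluteGaloisGroup L →* GL (Fin 3) (padicAlgClResidueField 3)) (c : absoluteGaloisGroup (NumberField.maximalRealSubfield L)), GaloisThorneData 𝓐 L (FramedGaloisRep.restrictField L ((ρy.restrictField F').twist θ)) (FramedGaloisRep.restrictField L (rc.twist θ)) τ c ∧ (FramedGaloisRep.restrictField L ((ρy.restrictField F').twist θ)).toGaloisRep.IsIrreducible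 ∧ (FramedGaloisRep.restrictField L (rc.twist θ)).toGaloisRep.IsIrreducible ∧ TracePolarized F' (-2) ((ρy.restrictField F').twist θ) ∧ (∀ w : HeightOneSpectrum (𝓞 F'), w ∉ S' → ((3 : ℕ) : 𝓞 F') ∉ w.asIdeal → FramedGaloisRep.IsUnramifiedAt w ((ρy.restrictField F').twist θ)) := by
  intro hF1 hF7 hF9 𝓐 h𝓐 f ι e S₀ ρC 𝓕 hgen hin hM hpur F' _ _ _ _ _ S' hdeg hsplit hrange hS' θ hθ y ρy hρy hirr rc
    hc hd₁ hd₂ hd₃ he hf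
  obtain ⟨ht1, ht2, ht3, ht4, ht5⟩ := hθ
  set ρ' : FramedGaloisRep F' (PadicAlgCl 3) 3 := (ρy.restrictField F').twist θ with hρ'def
  set r' : FramedGaloisRep F' (PadicAlgCl 3) 3 := rc.twist θ with hr'def
  have hD : ¬ IsSquare (f.map (Int.castRingHom ℚ)).discr := hM.1.2.1
  have hD3 : ¬ IsSquare ((-3 : ℚ) * (f.map (Int.castRingHom ℚ)).discr) := hM.1.2.2
  -- ### (i) polarization over `F'`
  have hpolH : TracePolarizedHom F' 𝓕.m ((pointRep 𝓕 y).comp (absGaloisRestrict K F').toMonoidHom) :=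
    arithmeticPoints_polarized f ι e S₀ ρC 𝓕 y hd₂ F'
  have hpolF : TracePolarized F' 𝓕.m (ρy.restrictField F') := by
    intro c₀ hc₀ σ
    have := hpolH c₀ hc₀ σ
    simpa [FramedRep.trace, FramedGaloisRep.restrictField_apply, hρy] using this
  have hθc := thetaPolarization_rat_of_maximalReal F' (-2 - 𝓕.m) θ ht2
  have hpol' : TracePolarized F' (-2) ρ' := by
    have := tracePolarized_twist F' 𝓕.m (-2 - 𝓕.m) (ρy.restrictField F') θ hpolF hθc
    rwa [show 𝓕.m + (-2 - 𝓕.m) = -2 by ring] at this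
  -- ### `θ` on global inertia (from the local clauses (t4), (t5))
  have hθglob : ∀ w : HeightOneSpectrum (𝓞 F'),
      (∀ τ ∈ absInertia (w.adicCompletion F'), θ (absGaloisRestrict F' (w.adicCompletion F') τ) = 1) →
      ∀ 𝔓 ∈ w.primesAbove, ∀ σ ∈ 𝔓.inertia (absoluteGaloisGroup F'), θ σ = 1 := by
    intro w hw 𝔓 h𝔓 σ hσ
    have hun : FramedGaloisRep.IsUnramifiedAt w (FramedRep.ofCharacter θ : FramedGaloisRep F' (PadicAlgCl 3) 1) := by
      rw [isUnramifiedAt_iff_forall_absInertia]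
      intro τ hτ
      exact (ofCharacter_apply_eq_one_iff θ _).2 (hw τ hτ)
    exact (ofCharacter_apply_eq_one_iff θ σ).1 (hun 𝔓 h𝔓 σ hσ)
  -- ### unramifiedness of `ρ'` and `r'` off `S' ∪ 3` over `F'`
  have hunrρ' : ∀ w : HeightOneSpectrum (𝓞 F'), w ∉ S' → ((3 : ℕ) : 𝓞 F') ∉ w.asIdeal →
      FramedGaloisRep.IsUnramifiedAt w ρ' := by
    intro w hwS hw3
    have hwS₀ : w.under (𝓞 K) ∉ S₀ := fun h => hwS (hS' w h)
    exact FramedGaloisRep.isUnramifiedAt_twist (pointRep_restrictField_isUnramifiedAt f ι e S₀ ρC 𝓕 y ρy hρy F' w hwS₀)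
      (hθglob w (ht4 w hw3 hwS))
  have hunrr' : ∀ w : HeightOneSpectrum (𝓞 F'), w ∉ S' → ((3 : ℕ) : 𝓞 F') ∉ w.asIdeal →
      FramedGaloisRep.IsUnramifiedAt w r' := fun w hwS hw3 =>
    FramedGaloisRep.isUnramifiedAt_twist (hf w hwS hw3) (hθglob w (ht4 w hw3 hwS))
  -- ### ordinary data at the places above `3` over `F'` (G4b + G4)
  have hord3 : ∀ w : HeightOneSpectrum (𝓞 F'), ((3 : ℕ) : 𝓞 F') ∈ w.asIdeal →
      ∃ wt' : LabelledWeight (w.adicCompletion F') (PadicAlgCl 3) 3,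
        (∀ τ (i j : Fin 3), i < j → wt' τ j + 2 ≤ wt' τ i) ∧
        FramedGaloisRep.IsOrdinaryOfLabelledWeightAt w (𝓐 F' w) ρ' wt' ∧
        FramedGaloisRep.IsOrdinaryOfLabelledWeightAt w (𝓐 F' w) r' wt' := by
    intro w hw
    obtain ⟨wt, hgaps, hrcord, g, Ue, hup, hdiag⟩ := he w hw (𝓐 F' w) (h𝓐 F' w)
    obtain ⟨kw, -, hθw⟩ := ht3 w hw
    have hθloc : ∃ U : OpenSubgroup (absoluteGaloisGroup (w.adicCompletion F')),
        ∀ τw ∈ WeilGroup.inertia (w.adicCompletion F'), WeilGroup.toAbsGalois (w.adicCompletion F') τw ∈ U →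
          ((θ (absGaloisRestrict F' (w.adicCompletion F') (WeilGroup.toAbsGalois (w.adicCompletion F') τw)) :
              (PadicAlgCl 3)ˣ) : PadicAlgCl 3) =
            algebraMap ℤ_[3] (PadicAlgCl 3)
              (GaloisRep.cyclotomicCharacter (w.adicCompletion F') 3 (WeilGroup.toAbsGalois (w.adicCompletion F') τw) :
                ℤ_[3]) ^ kw := by
      refine ⟨⊤, fun τw hτw _ => ?_⟩
      rw [hθw _ (WeilGroup.mem_inertia_iff.1 hτw)]
      set u := GaloisRep.cyclotomicCharacter (w.adicCompletion F') 3 (WeilGroup.toAbsGalois (w.adicCompletion F') τw)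
      calc algebraMap ℤ_[3] (PadicAlgCl 3) ((u ^ kw : ℤ_[3]ˣ) : ℤ_[3])
          = ((Units.map (algebraMap ℤ_[3] (PadicAlgCl 3) : ℤ_[3] →* PadicAlgCl 3) (u ^ kw) : (PadicAlgCl 3)ˣ) :
              PadicAlgCl 3) := (Units.coe_map _ _).symm
        _ = (algebraMap ℤ_[3] (PadicAlgCl 3) (u : ℤ_[3])) ^ kw := by
            rw [map_zpow, Units.val_zpow_eq_zpow_val, Units.coe_map]; rfl
    have hBorel : IsBorelOfWeightAt F' w (𝓐 F' w)
        ((ρy : absoluteGaloisGroup K →* GL (Fin 3) (PadicAlgCl 3)).comp (absGaloisRestrict K F').toMonoidHom) wt := by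
      refine ⟨g, Ue, fun τ => ?_, fun τw hτw hU i => ?_⟩
      · simpa [hρy] using hup τ
      · simpa [hρy] using hdiag τw hτw hU i
    have hordρ : (ρy.restrictField F').IsOrdinaryOfLabelledWeightAt w (𝓐 F' w) wt :=
      isOrdinaryOfLabelledWeightAt_restrictField_of_isBorelOfWeightAt F' w (𝓐 F' w) ρy wt hBorel
    exact ⟨fun τ j => wt τ j - kw, fun τ i j hij => by have := hgaps τ i j hij; simp only; omega,
      isOrdinaryOfLabelledWeightAt_twist hF9 F' w hw (𝓐 F' w) (h𝓐 F' w) _ wt θ kw hordρ hθloc,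
      isOrdinaryOfLabelledWeightAt_twist hF9 F' w hw (𝓐 F' w) (h𝓐 F' w) _ wt θ kw hrcord hθloc⟩
  -- ### the kill subgroups at the places of `S'`
  have hkill : ∀ v : HeightOneSpectrum (𝓞 F'), ∃ Uv : OpenSubgroup (absoluteGaloisGroup (v.adicCompletion F')),
      (v ∈ S' → ((3 : ℕ) : 𝓞 F') ∉ v.asIdeal →
        (∀ τ ∈ absInertia (v.adicCompletion F'), τ ∈ Uv → (ρy.restrictField F') (absGaloisRestrict F' (v.adicCompletion F') τ) = 1) ∧
        (∀ τ ∈ absInertia (v.adicCompletion F'), τ ∈ Uv → rc (absGaloisRestrict F' (v.adicCompletion F') τ) = 1) ∧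
        (∀ τ ∈ absInertia (v.adicCompletion F'), τ ∈ Uv → θ (absGaloisRestrict F' (v.adicCompletion F') τ) = 1)) ∧
      (((3 : ℕ) : 𝓞 F') ∈ v.asIdeal → ∃ wt' : LabelledWeight (v.adicCompletion F') (PadicAlgCl 3) 3,
        (∀ τ (i j : Fin 3), i < j → wt' τ j + 2 ≤ wt' τ i) ∧
        (∃ g : GL (Fin 3) (PadicAlgCl 3), FramedRep.IsUpperTriangular ((ρ'.toLocal v).conj g) ∧
          ∀ τw ∈ WeilGroup.inertia (v.adicCompletion F'), WeilGroup.toAbsGalois (v.adicCompletion F') τw ∈ Uv →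
            ∀ i : Fin 3, FramedRep.diagEntry ((ρ'.toLocal v).conj g) i (WeilGroup.toAbsGalois (v.adicCompletion F') τw) =
              (ordinaryWeightUnit wt' i ((𝓐 F' v).artin τw) : PadicAlgCl 3)) ∧
        (∃ g : GL (Fin 3) (PadicAlgCl 3), FramedRep.IsUpperTriangular ((r'.toLocal v).conj g) ∧
          ∀ τw ∈ WeilGroup.inertia (v.adicCompletion F'), WeilGroup.toAbsGalois (v.adicCompletion F') τw ∈ Uv →
            ∀ i : Fin 3, FramedRep.diagEntry ((r'.toLocal v).conj g) i (WeilGroup.toAbsGalois (v.adicCompletion F') τw) =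
              (ordinaryWeightUnit wt' i ((𝓐 F' v).artin τw) : PadicAlgCl 3))) := by
    intro v
    by_cases hv3 : ((3 : ℕ) : 𝓞 F') ∈ v.asIdeal
    · obtain ⟨wt', hgaps, hordρ', hordr'⟩ := hord3 v hv3
      rw [FramedGaloisRep.IsOrdinaryOfLabelledWeightAt, FramedGaloisRep.isOrdinaryOfLabelledWeight_iff] at hordρ' hordr'
      obtain ⟨gρ, hupρ, Uρ, hdiagρ⟩ := hordρ'
      obtain ⟨gr, hupr, Ur, hdiagr⟩ := hordr'
      refine ⟨Uρ ⊓ Ur, fun _ h => absurd hv3 h, fun _ => ⟨wt', hgaps, ⟨gρ, hupρ, fun τw hτw hU i => ?_⟩, ⟨gr, hupr, fun τw hτw hU i => ?_⟩⟩⟩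
      · exact hdiagρ τw hτw (OpenSubgroup.mem_inf.1 hU).1 i
      · exact hdiagr τw hτw (OpenSubgroup.mem_inf.1 hU).2 i
    · by_cases hvS : v ∈ S'
      · have hkρ : ∃ Uρ : OpenSubgroup (absoluteGaloisGroup (v.adicCompletion F')),
            ∀ τ ∈ absInertia (v.adicCompletion F'), τ ∈ Uρ →
              (ρy.restrictField F') (absGaloisRestrict F' (v.adicCompletion F') τ) = 1 := by
          by_cases hvS₀ : v.under (𝓞 K) ∈ S₀
          · exact exists_killSubgroup_pointRep_restrictField f ι e S₀ ρC 𝓕 hpur F' y ρy hρy v hvS₀ hv3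
          · refine ⟨⊤, fun τ hτ _ => ?_⟩
            exact (isUnramifiedAt_iff_forall_absInertia _ _).1
              (pointRep_restrictField_isUnramifiedAt f ι e S₀ ρC 𝓕 y ρy hρy F' v hvS₀) τ hτ
        obtain ⟨Uρ, hUρ⟩ := hkρ
        obtain ⟨Uc, hUc⟩ := hc v hvS hv3
        obtain ⟨Uθ, hUθ⟩ := ht5 v hvS hv3
        refine ⟨Uρ ⊓ Uc ⊓ Uθ, fun _ _ => ⟨fun τ hτ hU => hUρ τ hτ ?_, fun τ hτ hU => hUc τ hτ ?_, fun τ hτ hU => hUθ τ hτ ?_⟩,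
          fun h => absurd h hv3⟩
        · exact (OpenSubgroup.mem_inf.1 (OpenSubgroup.mem_inf.1 hU).1).1
        · exact (OpenSubgroup.mem_inf.1 (OpenSubgroup.mem_inf.1 hU).1).2
        · exact (OpenSubgroup.mem_inf.1 hU).2
      · exact ⟨⊤, fun h => absurd h hvS, fun h => absurd h hv3⟩
  choose U hU using hkill
  -- ### the disjointness field and the soluble CM extension (CHT 4.1.2)
  obtain ⟨D, iD, iDA, hDfin, hDrange⟩ := exists_disjointnessField_heart f ι e S₀ ρC 𝓕 F' hrange
  obtain ⟨L, iL, iNL, iAL, iGal, hsol, iCML, hDL, hcont⟩ := hF1 F' ‹_› D hDfin S' U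
  have hrangeL : (((rbar f 𝓕.B).comp (absGaloisRestrict K F').toMonoidHom).comp (absGaloisRestrict F' L).toMonoidHom).range =
      (rbar f 𝓕.B).range := hDrange L hDL
  -- ### the residual representation and the lift of complex conjugation
  obtain ⟨hρres, hadq, hρirr⟩ :=
    residual_adequate_twist_pointRep_tower f ι e S₀ ρC 𝓕 hgen hD hD3 F' L hrangeL y hd₂ ρy hρy θ ht1
  obtain ⟨hrres, hrirr⟩ :=
    residual_irreducible_twist_companion_tower f ι e S₀ ρC 𝓕 hgen F' L hrangeL y hd₁ hd₂ rc hd₃ θ ht1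
  obtain ⟨c, hcc⟩ := absGaloisQuot_surjective (NumberField.maximalRealSubfield L) L (NumberField.IsCMField.complexConj L)
  -- ### (i) over `L`
  have hpol'H : TracePolarizedHom F' (-2) (ρ' : absoluteGaloisGroup F' →* GL (Fin 3) (PadicAlgCl 3)) :=
    fun c₀ hc₀ σ => hpol' c₀ hc₀ σ
  have hiL : ∀ σ : absoluteGaloisGroup L,
      ((FramedGaloisRep.outerConj c (FramedGaloisRep.restrictField L ρ')) σ).val.trace =
        ((Units.map (algebraMap ℤ_[3] (PadicAlgCl 3)).toMonoidHom (GaloisRep.cyclotomicCharacter L 3 σ) ^ (1 - (3 : ℤ)) :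
            (PadicAlgCl 3)ˣ) : PadicAlgCl 3) * ((FramedGaloisRep.restrictField L ρ') σ⁻¹).val.trace := by
    intro σ
    have h' : (ρ' (absGaloisRestrict F' L (absGaloisOuterConj (NumberField.maximalRealSubfield L) L c σ))).val.trace =
        algebraMap ℤ_[3] (PadicAlgCl 3) (((GaloisRep.cyclotomicCharacter L 3 σ) ^ (-2 : ℤ) : ℤ_[3]ˣ) : ℤ_[3]) *
          (ρ' (absGaloisRestrict F' L σ⁻¹)).val.trace :=
      tracePolarizedHom_restrict_outerConj F' L (-2) (ρ' : absoluteGaloisGroup F' →* GL (Fin 3) (PadicAlgCl 3))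
        hpol'H c hcc σ
    have key : ∀ u : ℤ_[3]ˣ, algebraMap ℤ_[3] (PadicAlgCl 3) ((u ^ (-2 : ℤ) : ℤ_[3]ˣ) : ℤ_[3]) =
        ((Units.map (algebraMap ℤ_[3] (PadicAlgCl 3)).toMonoidHom u ^ (1 - (3 : ℤ)) : (PadicAlgCl 3)ˣ) : PadicAlgCl 3) := by
      intro u
      rw [show (1 - (3 : ℤ)) = -2 by norm_num,
        ← map_zpow (Units.map ((algebraMap ℤ_[3] (PadicAlgCl 3)).toMonoidHom)) u (-2 : ℤ), Units.coe_map]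
      rfl
    rw [FramedGaloisRep.outerConj_apply, FramedGaloisRep.restrictField_apply, FramedGaloisRep.restrictField_apply, h', key]
  -- ### unramifiedness over `L` at the places not above `3`
  have hunrL : ∀ u : HeightOneSpectrum (𝓞 L), ((3 : ℕ) : 𝓞 L) ∉ u.asIdeal →
      FramedGaloisRep.IsUnramifiedAt u (FramedGaloisRep.restrictField L ρ') ∧
        FramedGaloisRep.IsUnramifiedAt u (FramedGaloisRep.restrictField L r') := by
    intro u hu3
    haveI hlo : u.asIdeal.LiesOver (u.under (𝓞 F')).asIdeal := liesOver_under u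
    have hv3 : ((3 : ℕ) : 𝓞 F') ∉ (u.under (𝓞 F')).asIdeal := fun h =>
      hu3 ((natCast_mem_asIdeal_iff_of_liesOver (u.under (𝓞 F')) u 3).2 h)
    by_cases hvS : u.under (𝓞 F') ∈ S'
    · obtain ⟨hkρ, hkc, hkθ⟩ := (hU (u.under (𝓞 F'))).1 hvS hv3
      have hcv := hcont (u.under (𝓞 F')) hvS u hlo
      letI := (adicCompletionOfLiesOver F' L (u.under (𝓞 F')) u).toAlgebra
      haveI := isScalarTower_adicCompletionOfLiesOver (F := F') (E := L) (u.under (𝓞 F')) u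
      have hθL : ∀ 𝔓 ∈ u.primesAbove, ∀ σ ∈ 𝔓.inertia (absoluteGaloisGroup L),
          (θ.comp (absGaloisRestrict F' L)) σ = 1 := by
        intro 𝔓 h𝔓 σ hσ
        rw [ContinuousMonoidHom.coe_comp, Function.comp_apply]
        exact char_eq_one_inertia_of_local F' L θ (u.under (𝓞 F')) (U (u.under (𝓞 F'))) hkθ u hlo hcv 𝔓 h𝔓 σ hσ
      have h1 : FramedGaloisRep.IsUnramifiedAt u ((ρy.restrictField F').restrictField L) :=
        isUnramifiedAt_restrictField_of_openSubgroup (ρy.restrictField F') (u.under (𝓞 F')) (U (u.under (𝓞 F'))) hkρ u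
          (fun τ _ => hcv τ)
      have h2 : FramedGaloisRep.IsUnramifiedAt u (rc.restrictField L) :=
        isUnramifiedAt_restrictField_of_openSubgroup rc (u.under (𝓞 F')) (U (u.under (𝓞 F'))) hkc u (fun τ _ => hcv τ)
      have e1 : FramedGaloisRep.restrictField L ρ' =
          FramedRep.twist ((ρy.restrictField F').restrictField L) (θ.comp (absGaloisRestrict F' L)) := by
        rw [hρ'def]; exact FramedGaloisRep.restrictField_twist L _ θ
      have e2 : FramedGaloisRep.restrictField L r' = FramedRep.twist (rc.restrictField L) (θ.comp (absGaloisRestrict F' L)) := by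
        rw [hr'def]; exact FramedGaloisRep.restrictField_twist L _ θ
      rw [e1, e2]
      exact ⟨FramedGaloisRep.isUnramifiedAt_twist h1 hθL, FramedGaloisRep.isUnramifiedAt_twist h2 hθL⟩
    · exact ⟨isUnramifiedAt_restrictField_of_under_eq L ρ' (v := u.under (𝓞 F')) rfl (hunrρ' _ hvS hv3),
        isUnramifiedAt_restrictField_of_under_eq L r' (v := u.under (𝓞 F')) rfl (hunrr' _ hvS hv3)⟩
  -- ### (iii): almost everywhere unramified
  have hae : ∀ᶠ u : HeightOneSpectrum (𝓞 L) in cofinite, FramedGaloisRep.IsUnramifiedAt u (FramedGaloisRep.restrictField L ρ') := by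
    rw [Filter.eventually_cofinite]
    refine (finite_setOf_under_mem (k := F') (L := L) S').subset fun u hu => ?_
    by_contra hnot
    by_cases hu3 : ((3 : ℕ) : 𝓞 L) ∈ u.asIdeal
    · apply hnot
      haveI : u.asIdeal.LiesOver (u.under (𝓞 F')).asIdeal := liesOver_under u
      exact hS' _ (under_mem_of_three_mem hin _ ((natCast_mem_asIdeal_iff_of_liesOver (u.under (𝓞 F')) u 3).1 hu3))
    · exact hu (hunrL u hu3).1
  -- ### (iv)(b) at the places above `3`: transport, exactness, crystallinity
  have h3L : ∀ (u : HeightOneSpectrum (𝓞 L)) (hu : ((3 : ℕ) : 𝓞 L) ∈ u.asIdeal),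
      (fontainePstAdicCompletion u 3 hu).IsCrystallineFramed ((FramedGaloisRep.restrictField L ρ').toLocal u) ∧
      (fontainePstAdicCompletion u 3 hu).IsCrystallineFramed ((FramedGaloisRep.restrictField L r').toLocal u) ∧
      ∃ wt : LabelledWeight (u.adicCompletion L) (PadicAlgCl 3) 3,
        (FramedGaloisRep.restrictField L ρ').IsOrdinaryOfLabelledWeightAt u (𝓐 L u) wt ∧
        (FramedGaloisRep.restrictField L r').IsOrdinaryOfLabelledWeightAt u (𝓐 L u) wt := by
    intro u hu
    haveI hlo : u.asIdeal.LiesOver (u.under (𝓞 F')).asIdeal := liesOver_under u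
    have hv3 : ((3 : ℕ) : 𝓞 F') ∈ (u.under (𝓞 F')).asIdeal := (natCast_mem_asIdeal_iff_of_liesOver (u.under (𝓞 F')) u 3).1 hu
    have hvS : u.under (𝓞 F') ∈ S' := hS' _ (under_mem_of_three_mem hin _ hv3)
    obtain ⟨wt', hgaps, hordρ', hordr'⟩ := (hU (u.under (𝓞 F'))).2 hv3
    obtain ⟨wtL, hdomreg, htrans⟩ := ordinaryWeight_transport_exact 𝓐 h𝓐 F' L (u.under (𝓞 F')) u hlo hv3 wt'
    obtain ⟨hdom, hreg⟩ := hdomreg hgaps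
    have hcontv := hcont (u.under (𝓞 F')) hvS u hlo
    obtain ⟨gρ, hupρ, hdiagρ⟩ := htrans ρ' (U (u.under (𝓞 F'))) hordρ' hcontv
    obtain ⟨gr, hupr, hdiagr⟩ := htrans r' (U (u.under (𝓞 F'))) hordr' hcontv
    refine ⟨?_, ?_, wtL, ?_, ?_⟩
    · exact GeeGeraghty2012.crystalline_of_ordinary_regular_at hF7 u hu (𝓐 L u) (h𝓐 L u) _ wtL hdom hreg
        ⟨gρ, hupρ, hdiagρ⟩
    · exact GeeGeraghty2012.crystalline_of_ordinary_regular_at hF7 u hu (𝓐 L u) (h𝓐 L u) _ wtL hdom hreg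
        ⟨gr, hupr, hdiagr⟩
    · rw [FramedGaloisRep.IsOrdinaryOfLabelledWeightAt, FramedGaloisRep.isOrdinaryOfLabelledWeight_iff]
      exact ⟨gρ, hupρ, ⊤, fun τw hτw _ i => hdiagρ τw hτw i⟩
    · rw [FramedGaloisRep.IsOrdinaryOfLabelledWeightAt, FramedGaloisRep.isOrdinaryOfLabelledWeight_iff]
      exact ⟨gr, hupr, ⊤, fun τw hτw _ i => hdiagr τw hτw i⟩
  -- ### assembly
  refine ⟨L, iL, iNL, iCML, iAL, iGal, hsol, _, c, ⟨hcc, hiL, hρres, hadq, hae, hrres,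
    fun u hu3 => hunrL u hu3, h3L⟩, hρirr, hrirr, hpol', hunrρ'⟩

end

end Summit.Langlands.Langlands.Cruxes.MuOrdinaryFamilyRT.ThorneMinimalLift
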